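import Summits.CriticalPhenomena.PercolationContinuityZ3.Theorems.PercNearOneGluingNoHeavyQuantGatedSliceMixLawRegimeBTools
import HarnessLib

/-!
# QUANT lane R8, T-DEC, leg (III), blob case — `LawDec.GatedSliceMixLaw'` in REGIME B (the weak-mid law's shifted atom `h + a` is a
# GIANT), cell B-G (`k₂` a giant), the CHEAP-`k₁` sub-cell: the SECOND KINK of the mixture budget (the mid `h` exactly full of BOTH
# nonzero lows of the moved law), a usage bound `usage(ℓ,m)·(m − S) ≤ t − ℓ`, and the one real inequality behind it

builds on p205010 (kernel theorem, internal audit signed; external expert review pending)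

Support file (`--supports stmt-CriticalPhenomena-4575`), QUANT lane lead seat (gen 32), rung R8 of `run/shared/lean/prim/quant/LADDER.md`.
Memo `run/shared/lean/prim/quant/prim-quant-lead-g32/FOR-PROVERS-MIXLAW-KINKS.md` §2.  Theorems only, standard axioms, no sorries.
Tools: `…QuantGatedSliceMixLawRegimeBTools` (this seat: `usage_mul_sub_le_light_or`, `mixLawB_S1`, `mixLawB_QG`), typer g30's
`…QuantGatedSliceMixLawExchange` (pair flows, the cone structure of `FlowAtT`, the explicit moved two-point law, the conclusion wrapper),
`flowAtT_of_giants` (criterion E).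

THE CELL.  Frame of `GatedSliceMixLaw'` (`t = S + ag(1−z)`); regime B: `h + a ≥ j + 1` (so `W_h = (1 − S/h)δ₀ + (S/h)(1−g)δ_h + (S/h)g δ_{h+a}`
has ONE mid `h` and one giant); `k₂ ≥ j + 1` (both absorbers `k₂`, `k₂ + a` of the moved law `P[μ₂]` are giants); `d = k₁ + a` a `t`-low
(`2d < t`, `d ≤ j`), `h` a mid (`2h ≥ t`).  The mixture `Q_θ = θ·W_h + (1−θ)·P[μ₂]` has lows `0, k₁, d`, ONE mid
`h` and a pool of giants, so its DEC problem is a fractional knapsack whose optimum is the deepest-first greedy; its budget is concave piecewise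
affine in `θ` with kinks K1 (`h` exactly full of `d`; arm-3 g64's (K), typer g29's budget point, lead g31's N121) and K2 (`h` exactly full of
`d` AND `k₁`).  Lead g32's census (route2/route3/cellBG, ≈ 3·10⁶ exact instances, M ≤ 40): K1 certifies every instance of the cell in which
`k₁` is DEAR at `h` (`k₁ + h ≤ t` or `ρ₁ = (t − 2k₁)/(h − k₁) ≥ y`) and FAILS for genuine instances in the corner `h ≫ t` where `k₁` is CHEAP at
`h` (`ρ₁ < y`: the pair `(k₁, h)` is light and costs less than a giant) — e.g. `y = 1/3, z = 0, g = 1/3, S = 4, a = 1, j = 11, M = 12, h = 11,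
μ₂ = {1, 12; 3/11}` (exact `θ`-interval `[17/122, 2374/2605]`, K1 `= 0.1357` outside, K2 `= 0.469` inside); there K2 certifies (0 / 64 699).
THIS FILE proves the cheap sub-cell (tools in the companion `…RegimeBTools`: `usage_mul_sub_le_light_or`, `mixLawB_S1`, `mixLawB_QG`):

* **`LawDec.gatedSliceMixLaw_regimeB_cheap`** — the conclusion of `GatedSliceMixLaw'` on cell B-G when `t < k₁ + h`, `(t − 2k₁) < y(h − k₁)` and
  `g < 1` (`k₁ = 0` allowed) (`g = 1` makes `W_h` DEC in regime B, `LawDec.decAtT_weakMidLaw_of_giant`, so the assembler discharges it from `¬DEC(W_h)`): at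
  `θ = K2` the flow is pair(`d → h`) + pair(`k₁ → h`) + criterion E for the zeros against the giants `h+a, k₂, k₂+a`, and the giant inequality is
  (E″) `D(u w₀ − W_G) ≤ w_h((1−z)λ − uz)`, `D = usage(d,h)·m_d + usage(k₁,h)·m₁ ≤ (1−z)(1−λ)(S−k₁−agz)/(h−S)` by `usage_mul_sub_le_light_or` twice.
The dear sub-cell (K1, inequality (E′)) and cell B-M (`k₂ ≤ j`) are the remaining regime-B files (memo §2; `¬DEC(W_h)` is load-bearing there).

[this work]; exchange architecture: prim-quant-stmt g30; flow form / criterion E / usage closed forms: prim-quant-stmt g22–g27, arm-1 g39, lead g21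
(this lane); cell map: arm-3 g63–g64, lead g31–g32.  Nothing here is cited as a published result.  The gluing rows served
[cite: KozmaNitzan2024, Conjecture 3 (p. 15)]; product measure [cite: Grimmett1999, §1.3 p. 10].
-/

noncomputable section

namespace Summit.CriticalPhenomena.PercolationContinuityZ3.Theorems

namespace Quant

open Finset

/-- the two-point law `{lo, hi; g}` (as in `…QuantLawDEC`) -/
local notation3 "TP[" lo ", " hi ", " g ", " h "]" =>
  (g : ℝ) * (if (h : ℕ) = (hi : ℕ) then (1 : ℝ) else 0) + (1 - (g : ℝ)) * (if (h : ℕ) = (lo : ℕ) then (1 : ℝ) else 0)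

namespace LawDec

/-! ### The cheap sub-cell of cell B-G: the second kink -/

set_option maxHeartbeats 800000 in
/-- **`GatedSliceMixLaw'` ON CELL B-G, CHEAP `k₁`** — regime B (`h + a ≥ j+1`), `k₂ ≥ j+1`, `d = k₁ + a` a `t`-low, `h` a mid,
`t < k₁ + h` and the pair `(k₁, h)` light (`t − 2k₁ < y(h − k₁)`), `g < 1`: the conclusion of `GatedSliceMixLaw'` at the second kink
`θ = D/(w_h + D)`, `D = usage(d,h)·m_d + usage(k₁,h)·m₁` (the mid `h` exactly full of both nonzero lows of the moved law; the zeros ride the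
giants `h + a`, `k₂`, `k₂ + a`).  `W_h ∉ D` is not used beyond `g < 1` (`decAtT_weakMidLaw_of_giant`). [this work] -/
theorem gatedSliceMixLaw_regimeB_cheap (y z g S lam : ℝ) (a j M h k₁ k₂ : ℕ)
    (hy0 : 0 < y) (hy1 : y < 1) (hz0 : 0 ≤ z) (hz1 : z < 1) (hg1 : g < 1) (hyg : y ≤ (1 - z) * g)
    (hS0 : 0 < S) (hta : y * (M : ℝ) ≤ S) (hhj : h ≤ j) (hhM : h ≤ M) (hSh : S < (h : ℝ))
    (hk : k₁ ≤ k₂) (hk₂M : k₂ ≤ M) (hlam0 : 0 ≤ lam) (hlam1 : lam ≤ 1)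
    (hmean : (1 - z) * ((k₁ : ℝ) + ((k₂ : ℝ) - k₁) * lam) = S)
    (hdlow : 2 * ((k₁ + a : ℕ) : ℝ) < S + (a : ℝ) * g * (1 - z)) (hdj : k₁ + a ≤ j)
    (hk₂G : j + 1 ≤ k₂) (hhaG : j + 1 ≤ h + a) (hhmid : S + (a : ℝ) * g * (1 - z) ≤ 2 * (h : ℝ))
    (hcomp₁ : S + (a : ℝ) * g * (1 - z) < (k₁ : ℝ) + h)
    (hcheap : S + (a : ℝ) * g * (1 - z) - 2 * (k₁ : ℝ) < y * ((h : ℝ) - k₁)) :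
    ∃ θ : ℝ, 0 ≤ θ ∧ θ < 1 ∧
      DECAtT y (S + (a : ℝ) * g * (1 - z)) j (M + a)
        (fun p => θ * weakMidLaw S g h a p
          + (1 - θ) * (z * (if p = 0 then (1 : ℝ) else 0) + (1 - z) * slice (fun q => TP[k₁, k₂, lam, q]) a g p)) := by
  classical
  set t : ℝ := S + (a : ℝ) * g * (1 - z) with ht
  -- positivity
  have h1z : 0 < 1 - z := by linarith
  have hg0 : 0 < g := by nlinarith
  have h1y : 0 < 1 - y := by linarith
  have h1g : 0 < 1 - g := by linarith
  have ha0 : (0 : ℝ) ≤ a := Nat.cast_nonneg a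
  have hk₁0 : (0 : ℝ) ≤ k₁ := Nat.cast_nonneg k₁
  have hh0 : (0 : ℝ) < h := lt_trans hS0 hSh
  have hhS : 0 < (h : ℝ) - S := by linarith
  have hu0 : 0 < y / (1 - y) := div_pos hy0 h1y
  have h1lam : 0 ≤ 1 - lam := by linarith
  have hyz : y + z ≤ 1 := by nlinarith
  have hagz : 0 ≤ (a : ℝ) * g * z := mul_nonneg (mul_nonneg ha0 hg0.le) hz0
  have hag1 : (a : ℝ) * g * (1 - z) ≤ a := by nlinarith [mul_nonneg ha0 hg0.le]
  have hSt : S ≤ t := by rw [ht]; nlinarith [mul_nonneg (mul_nonneg ha0 hg0.le) h1z.le]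
  have hdcast : ((k₁ + a : ℕ) : ℝ) = (k₁ : ℝ) + a := by push_cast; ring
  have hdlow' : 2 * ((k₁ : ℝ) + a) < t := by rw [← hdcast]; exact hdlow
  have hk1low : 2 * (k₁ : ℝ) < t := by linarith
  have hyh : y * (h : ℝ) ≤ S := le_trans (mul_le_mul_of_nonneg_left (by exact_mod_cast hhM) hy0.le) hta
  have hyk₂ : y * (k₂ : ℝ) ≤ S := le_trans (mul_le_mul_of_nonneg_left (by exact_mod_cast hk₂M) hy0.le) hta
  have hk12 : (k₁ : ℝ) < k₂ := by
    have : k₁ < k₂ := by omega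
    exact_mod_cast this
  have hTk₂ : S ≤ (1 - z) * (k₂ : ℝ) := by
    -- S = (1−z)(k₁ + (k₂−k₁)λ) ≤ (1−z)k₂
    have : (k₁ : ℝ) + ((k₂ : ℝ) - k₁) * lam ≤ k₂ := by nlinarith
    nlinarith
  have hSk₁ : 0 ≤ S - k₁ - (a : ℝ) * z := by nlinarith [mul_nonneg ha0 hz0, mul_nonneg ha0 hg0.le]
  -- masses
  set m₁ : ℝ := (1 - z) * (1 - lam) * (1 - g) with hm₁
  set m₂ : ℝ := (1 - z) * (1 - lam) * g with hm₂
  have hm₁0 : 0 ≤ m₁ := mul_nonneg (mul_nonneg h1z.le h1lam) h1g.le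
  have hm₂0 : 0 ≤ m₂ := mul_nonneg (mul_nonneg h1z.le h1lam) hg0.le
  have hwh : 0 < S / h * (1 - g) := mul_pos (div_pos hS0 hh0) h1g
  have hw0 : 0 ≤ 1 - S / (h : ℝ) := by rw [sub_nonneg, div_le_one hh0]; exact hSh.le
  have hWG : 0 ≤ S / h * g := mul_nonneg (div_pos hS0 hh0).le hg0.le
  -- usage rates of the two nonzero lows at the mid h, and their bounds
  have hcompd : t < ((k₁ + a : ℕ) : ℝ) + h := by rw [hdcast]; linarith
  have hdh : k₁ + a < h := by
    have : ((k₁ + a : ℕ) : ℝ) < h := by rw [hdcast]; linarith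
    exact_mod_cast this
  have hk1h : k₁ < h := by omega
  have hUd0 : 0 < usage y t j (k₁ + a) h := usage_pos_of_compat y t j (k₁ + a) h hy0 hy1 hdlow hdh (Or.inr hcompd)
  have hU10 : 0 < usage y t j k₁ h := usage_pos_of_compat y t j k₁ h hy0 hy1 hk1low hk1h (Or.inr hcomp₁)
  have hUd : usage y t j (k₁ + a) h * ((h : ℝ) - S) ≤ t - ((k₁ + a : ℕ) : ℝ) :=
    usage_mul_sub_le_light_or y t S j (k₁ + a) h hy0 hy1 hdlow hhj hcompd hyh hSh hSt
      (Or.inr (by rw [hdcast, ht]; linarith))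
  have hU1 : usage y t j k₁ h * ((h : ℝ) - S) ≤ t - k₁ :=
    usage_mul_sub_le_light_or y t S j k₁ h hy0 hy1 hk1low hhj hcomp₁ hyh hSh hSt (Or.inl hcheap)
  obtain ⟨Ud, hUdd⟩ : ∃ q : ℝ, q = usage y t j (k₁ + a) h := ⟨_, rfl⟩
  obtain ⟨U1, hU1d⟩ : ∃ q : ℝ, q = usage y t j k₁ h := ⟨_, rfl⟩
  rw [← hUdd] at hUd0 hUd
  rw [← hU1d] at hU10 hU1
  obtain ⟨D, hD⟩ : ∃ q : ℝ, q = Ud * m₂ + U1 * m₁ := ⟨_, rfl⟩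
  have hD0 : 0 ≤ D := by rw [hD]; exact add_nonneg (mul_nonneg hUd0.le hm₂0) (mul_nonneg hU10.le hm₁0)
  -- D(h − S) ≤ (1−z)(1−λ)(S − k₁ − agz)
  have hDle : D * ((h : ℝ) - S) ≤ (1 - z) * (1 - lam) * (S - k₁ - (a : ℝ) * g * z) := by
    have e : (1 - z) * (1 - lam) * (S - k₁ - (a : ℝ) * g * z) = (t - ((k₁ : ℝ) + a)) * m₂ + (t - k₁) * m₁ := by
      simp only [hm₁, hm₂, ht]; ring
    have h1 := mul_le_mul_of_nonneg_right hUd hm₂0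
    have h2 := mul_le_mul_of_nonneg_right hU1 hm₁0
    rw [hdcast] at h1
    have e2 : D * ((h : ℝ) - S) = Ud * ((h : ℝ) - S) * m₂ + U1 * ((h : ℝ) - S) * m₁ := by rw [hD]; ring
    rw [e, e2]
    exact add_le_add h1 h2
  -- the giant inequality (E″): D(u w₀ − W_G) ≤ w_h((1−z)λ − u z), via S1 / QG
  have hk₁S : (k₁ : ℝ) ≤ S := by linarith [mul_nonneg ha0 hz0]
  have hQG : y / (1 - y) * z ≤ (1 - z) * lam :=
    mixLawB_QG y z S lam k₁ k₂ hy0 hy1 hz0 hyz hk12 hk₁S hyk₂ hmean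
  have hE'' : D * (y / (1 - y) * (1 - S / h) - S / h * g) ≤ S / h * (1 - g) * ((1 - z) * lam - y / (1 - y) * z) := by
    -- multiply by h: D(u(h−S) − Sg) ≤ S(1−g)((1−z)λ − uz)
    have eW : y / (1 - y) * (1 - S / h) - S / h * g = (y / (1 - y) * ((h : ℝ) - S) - S * g) / h := by
      field_simp
    have eR : S / h * (1 - g) * ((1 - z) * lam - y / (1 - y) * z) = S * (1 - g) * ((1 - z) * lam - y / (1 - y) * z) / h := by
      field_simp
    rw [eW, eR, mul_div_assoc', div_le_div_iff_of_pos_right hh0]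
    by_cases hX : 0 ≤ y / (1 - y) * ((h : ℝ) - S) - S * g
    · have hS1 := mixLawB_S1 y z g S lam h a k₁ k₂ hy0 hy1 hz0 hyz hg0.le hg1.le ha0 hS0 hSh hyh hk12 hyk₂ hTk₂ hSk₁ hmean
      -- D·X·(h−S) ≤ N̄·X ≤ S(1−g)(h−S)((1−z)λ − uz)
      have h1 : D * (y / (1 - y) * ((h : ℝ) - S) - S * g) * ((h : ℝ) - S)
          ≤ (1 - z) * (1 - lam) * (S - k₁ - (a : ℝ) * g * z) * (y / (1 - y) * ((h : ℝ) - S) - S * g) := by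
        have := mul_le_mul_of_nonneg_right hDle hX
        calc D * (y / (1 - y) * ((h : ℝ) - S) - S * g) * ((h : ℝ) - S)
            = D * ((h : ℝ) - S) * (y / (1 - y) * ((h : ℝ) - S) - S * g) := by ring
          _ ≤ _ := this
      have h2 : D * (y / (1 - y) * ((h : ℝ) - S) - S * g) * ((h : ℝ) - S)
          ≤ S * (1 - g) * ((1 - z) * lam - y / (1 - y) * z) * ((h : ℝ) - S) := by
        calc D * (y / (1 - y) * ((h : ℝ) - S) - S * g) * ((h : ℝ) - S)
            ≤ (1 - z) * (1 - lam) * (S - k₁ - (a : ℝ) * g * z) * (y / (1 - y) * ((h : ℝ) - S) - S * g) := h1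
          _ ≤ S * (1 - g) * ((h : ℝ) - S) * ((1 - z) * lam - y / (1 - y) * z) := hS1
          _ = S * (1 - g) * ((1 - z) * lam - y / (1 - y) * z) * ((h : ℝ) - S) := by ring
      exact le_of_mul_le_mul_right h2 hhS
    · have hXn : y / (1 - y) * ((h : ℝ) - S) - S * g < 0 := not_le.1 hX
      have h1 : D * (y / (1 - y) * ((h : ℝ) - S) - S * g) ≤ 0 := mul_nonpos_of_nonneg_of_nonpos hD0 hXn.le
      have h2 : 0 ≤ S * (1 - g) * ((1 - z) * lam - y / (1 - y) * z) := mul_nonneg (mul_nonneg hS0.le h1g.le) (by linarith)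
      linarith
  -- the three flow pieces of the unnormalised mixture D·W_h + w_h·P
  have Pd := flowAtT_pair y t j (M + a) (k₁ + a) h (S / h * (1 - g) * m₂) (Ud * (S / h * (1 - g) * m₂)) hdj hdlow (by omega)
    (Or.inr hhmid) (Or.inr hcompd) (mul_nonneg hwh.le hm₂0) (le_of_eq (by rw [hUdd]))
  have P1 := flowAtT_pair y t j (M + a) k₁ h (S / h * (1 - g) * m₁) (U1 * (S / h * (1 - g) * m₁)) (by omega) hk1low (by omega)
    (Or.inr hhmid) (Or.inr hcomp₁) (mul_nonneg hwh.le hm₁0) (le_of_eq (by rw [hU1d]))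
  -- the giants piece: zeros + the three giant atoms
  set G : ℕ → ℝ := fun p => (D * (1 - S / h) + S / h * (1 - g) * z) * (if p = 0 then (1 : ℝ) else 0)
      + D * (S / h * g) * (if p = h + a then (1 : ℝ) else 0)
      + S / h * (1 - g) * ((1 - z) * lam * (1 - g)) * (if p = k₂ then (1 : ℝ) else 0)
      + S / h * (1 - g) * ((1 - z) * lam * g) * (if p = k₂ + a then (1 : ℝ) else 0) with hG
  have hind : ∀ (q : Prop) [Decidable q], (0 : ℝ) ≤ (if q then (1 : ℝ) else 0) := by
    intro q _; split <;> norm_num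
  have hc0 : 0 ≤ D * (1 - S / h) + S / h * (1 - g) * z := add_nonneg (mul_nonneg hD0 hw0) (mul_nonneg hwh.le hz0)
  have hc1 : 0 ≤ D * (S / h * g) := mul_nonneg hD0 hWG
  have hc2 : 0 ≤ S / h * (1 - g) * ((1 - z) * lam * (1 - g)) := mul_nonneg hwh.le (mul_nonneg (mul_nonneg h1z.le hlam0) h1g.le)
  have hc3 : 0 ≤ S / h * (1 - g) * ((1 - z) * lam * g) := mul_nonneg hwh.le (mul_nonneg (mul_nonneg h1z.le hlam0) hg0.le)
  have hG0 : ∀ p, 0 ≤ G p := by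
    intro p
    simp only [hG]
    exact add_nonneg (add_nonneg (add_nonneg (mul_nonneg hc0 (hind _)) (mul_nonneg hc1 (hind _))) (mul_nonneg hc2 (hind _)))
      (mul_nonneg hc3 (hind _))
  -- sums of G over the lows and over the giants
  have hGlow : ∑ l ∈ Finset.range (j + 1), G l = D * (1 - S / h) + S / h * (1 - g) * z := by
    simp only [hG, Finset.sum_add_distrib]
    rw [sum_mul_indicator (fun _ => D * (1 - S / h) + S / h * (1 - g) * z) j 0 (by omega),
      sum_mul_indicator_eq_zero (fun _ => D * (S / h * g)) j (h + a) (by omega),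
      sum_mul_indicator_eq_zero (fun _ => S / h * (1 - g) * ((1 - z) * lam * (1 - g))) j k₂ (by omega),
      sum_mul_indicator_eq_zero (fun _ => S / h * (1 - g) * ((1 - z) * lam * g)) j (k₂ + a) (by omega)]
    ring
  have hGall : ∑ p ∈ Finset.range (M + a + 1), G p
      = D * (1 - S / h) + S / h * (1 - g) * z + (D * (S / h * g) + S / h * (1 - g) * ((1 - z) * lam * (1 - g))
        + S / h * (1 - g) * ((1 - z) * lam * g)) := by
    simp only [hG, Finset.sum_add_distrib]
    rw [sum_mul_indicator (fun _ => D * (1 - S / h) + S / h * (1 - g) * z) (M + a) 0 (by omega),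
      sum_mul_indicator (fun _ => D * (S / h * g)) (M + a) (h + a) (by omega),
      sum_mul_indicator (fun _ => S / h * (1 - g) * ((1 - z) * lam * (1 - g))) (M + a) k₂ (by omega),
      sum_mul_indicator (fun _ => S / h * (1 - g) * ((1 - z) * lam * g)) (M + a) (k₂ + a) (by omega)]
    ring
  have hGIco : ∑ p ∈ Finset.Ico (j + 1) (M + a + 1), G p
      = D * (S / h * g) + S / h * (1 - g) * ((1 - z) * lam * (1 - g)) + S / h * (1 - g) * ((1 - z) * lam * g) := by
    have := Finset.sum_range_add_sum_Ico G (show j + 1 ≤ M + a + 1 by omega)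
    rw [hGall, hGlow] at this
    linarith
  have PG : FlowAtT y t j (M + a) G := by
    refine flowAtT_of_giants y t j (M + a) G hy0 hy1 hG0 ?_
    have hle : ∑ l ∈ Finset.range (j + 1), (if 2 * (l : ℝ) < t then G l else 0) ≤ D * (1 - S / h) + S / h * (1 - g) * z := by
      rw [← hGlow]
      exact Finset.sum_le_sum fun l _ => by
        by_cases h2 : 2 * (l : ℝ) < t
        · rw [if_pos h2]
        · rw [if_neg h2]; exact hG0 l
    rw [hGIco]
    refine le_trans (mul_le_mul_of_nonneg_left hle hu0.le) ?_
    -- u(D w₀ + w_h z) ≤ D W_G + w_h Q_G  ⟸  (E″)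
    have e : D * (S / h * g) + S / h * (1 - g) * ((1 - z) * lam * (1 - g)) + S / h * (1 - g) * ((1 - z) * lam * g)
        = D * (S / h * g) + S / h * (1 - g) * ((1 - z) * lam) := by ring
    rw [e]
    nlinarith [hE'']
  -- assemble: D·W_h + w_h·P is flow-feasible
  have hsum := FlowAtT.add (FlowAtT.add Pd P1) PG
  have key : ∀ p, D * weakMidLaw S g h a p
        + S / h * (1 - g) * (z * (if p = 0 then (1 : ℝ) else 0) + (1 - z) * slice (fun q => TP[k₁, k₂, lam, q]) a g p)
      = (S / h * (1 - g) * m₂ * (if p = k₁ + a then (1 : ℝ) else 0) + Ud * (S / h * (1 - g) * m₂) * (if p = h then (1 : ℝ) else 0))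
        + (S / h * (1 - g) * m₁ * (if p = k₁ then (1 : ℝ) else 0) + U1 * (S / h * (1 - g) * m₁) * (if p = h then (1 : ℝ) else 0))
        + G p := by
    intro p
    rw [movedTwoPoint_apply]
    simp only [weakMidLaw, hG, hm₁, hm₂]
    rw [hD, hm₁, hm₂]
    ring
  have hR' : FlowAtT y t j (M + a) (fun p => D * weakMidLaw S g h a p
      + S / h * (1 - g) * (z * (if p = 0 then (1 : ℝ) else 0) + (1 - z) * slice (fun q => TP[k₁, k₂, lam, q]) a g p)) := by
    refine (congrArg (FlowAtT y t j (M + a)) (funext fun p => ?_)).mp hsum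
    exact (key p).symm
  -- normalise: θ = D/(w_h + D)
  have hden : 0 < S / h * (1 - g) + D := add_pos_of_pos_of_nonneg hwh hD0
  obtain ⟨θ, hθ⟩ : ∃ q : ℝ, q = D / (S / h * (1 - g) + D) := ⟨_, rfl⟩
  have hθ0 : 0 ≤ θ := by rw [hθ]; exact div_nonneg hD0 hden.le
  have hθ1 : θ < 1 := by rw [hθ, div_lt_one hden]; linarith
  have h1θ : 1 - θ = S / h * (1 - g) / (S / h * (1 - g) + D) := by
    rw [hθ]; field_simp; ring
  have hR := hR'.smul (1 / (S / h * (1 - g) + D)) (by positivity)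
  refine gatedSliceMixLaw_conclusion_of_flowAtT y z g S lam θ a j M h k₁ k₂ hy0 hy1 hhM hk hk₂M hθ0 hθ1 ?_
  refine (congrArg (FlowAtT y t j (M + a)) (funext fun p => ?_)).mp hR
  rw [h1θ, hθ, div_eq_mul_one_div D, div_eq_mul_one_div (S / h * (1 - g)) (S / h * (1 - g) + D)]
  ring

end LawDec

end Quant

end Summit.CriticalPhenomena.PercolationContinuityZ3.Theorems
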